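import Literature.NumberTheory.DiophantineGeometry.GenEllDePersistentValues
import HarnessLib

/-!
# [GenEll] Thm. 2.1 for `ℙ¹`, the `D_e` route: the persistent family drawn from a prescribed pool

S. Mochizuki, *Arithmetic elliptic curves in general position*, Math. J. Okayama Univ. 52 (2010)
[cite: MochizukiGenEll2010, Thm 2.1 p.12].  Local steps of OUR proof of the `ℙ¹` case via the
superelliptic curves `D_e : r^{2k+1} = x(1−x)` and the one-parameter family of functions
`t_c = 1/r + c·r^{k+1}/(1−2x)` (abc-iut cell, GenEllTwo assembly; route item of
`Summit.ABC.ABC.Theses.IUTThetaPilot`).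

The «bad-`c` lemma» files (`GenEllDeCriticalCollisions`, `GenEllDePersistentFamily`,
`GenEllDePersistentPolys`, `GenEllDePersistentValues`) produce, for every `n`, nonzero pairwise
distinct rationals `c_1, …, c_n` with pairwise DISJOINT persistent sets, packaged as pairwise coprime
`ℚ`-polynomials `Pers_i`.  The closing argument wants two refinements, both bookkeeping over the
landed decls (kernel text first written in the abc-iut audit lane by seat abc-iut-w5-d037, adopted
here by the holder):

* `DeFamily.exists_finset_params_pairwise_disjoint_of_infinite` — the parameters may be drawn from
  ANY prescribed infinite set `C ⊆ ℚ` (the closing file takes `C = {2^j : j ∈ ℕ}`, so that the primes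
  of `c_i` are `⊆ {2}` uniformly in `i`): the induction of `exists_finset_params_pairwise_disjoint`
  verbatim, each step excluding finitely many rationals;
* `DeFamily.exists_persistent_polys_of_infinite` — the indexed polynomial form: `c : Fin n → C`,
  injective, nonzero, `Pers_i ≠ 0` pairwise coprime, and ROOT CONTAINMENT AT EVERY FIELD OF
  CHARACTERISTIC `0` AT ONCE (one family serves `ℂ` and every `Q̄_p` simultaneously);
* `DeFamily.exists_persistent_polys_allFields` — the pool-free special case;
* `DeFamily.exists_persistent_polys_tval_of_infinite` — the same family with the root clause in the
  `t_c`-VALUE form of `GenEllDePersistentValues` (hypothesis `hCV` of the configuration-protection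
  step), again for all fields at once;
* `DeFamily.aeval_persPoly_eq_zero_of_charZero` — `[IsAlgClosed Ω]` in `aeval_persPoly_eq_zero` is
  idle: root containment holds in ANY field of characteristic `0`;
* `DeFamily.infinite_range_two_pow` — the pool `{2^j}` is infinite (non-vacuity of the above).

Theorems only; classical; nothing here bears on the disputed parts of the abc-iut corpus.
-/

noncomputable section

open Polynomial
open scoped Classical

namespace Literature.NumberTheory.DiophantineGeometry.GenEll

namespace DeFamily

/-- `[IsAlgClosed Ω]` is idle in `aeval_persPoly_eq_zero`: for ANY field `Ω` of characteristic `0`,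
`k ≥ 2`, `c ≠ 0`, the persistent polynomial `Pers_c` vanishes at every element of the persistent set of
`c` in `Ω` (the persistent configuration is algebraic, so it lives in the algebraic closure of `ℚ` in
`Ω`, which embeds into `Q̄`). [cite: MochizukiGenEll2010, Thm 2.1 p.12] -/
theorem aeval_persPoly_eq_zero_of_charZero {Ω : Type*} [Field Ω] [CharZero Ω] {k : ℕ}
    (hk : 2 ≤ k) {c : ℚ} (hc : c ≠ 0) {a : Ω} (ha : a ∈ persistentSet k (c : Ω)) :
    aeval a (persPoly hk hc) = 0 := by
  haveI hK : Algebra.IsAlgebraic ℚ (AlgebraicClosure ℚ) := AlgebraicClosure.isAlgebraic ℚ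
  haveI hLalg : Algebra.IsAlgebraic ℚ (algebraicClosure ℚ Ω) := algebraicClosure.isAlgebraic ℚ Ω
  obtain ⟨P, rfl, hP, hns, Q, hQ, hN, hcol⟩ := ha
  obtain ⟨hP1, hP2, hQ1, hQ2⟩ := mem_algebraicClosure_of_persistent hk hc hP hQ hN hcol
  let L : IntermediateField ℚ Ω := algebraicClosure ℚ Ω
  let P' : L × L := (⟨P.1, hP1⟩, ⟨P.2, hP2⟩)
  let Q' : L × L := (⟨Q.1, hQ1⟩, ⟨Q.2, hQ2⟩)
  have hP'1 : (algebraMap L Ω P'.1, algebraMap L Ω P'.2) = P := rfl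
  have hQ'1 : (algebraMap L Ω Q'.1, algebraMap L Ω Q'.2) = Q := rfl
  have hmem : (P'.1 : L) ∈ persistentSet k (c : L) := by
    refine ⟨P', rfl, ?_, ?_, Q', ?_, ?_, ?_⟩
    · exact (map_onCurve_iff (algebraMap L Ω) k P').mp (hP'1 ▸ hP)
    · exact (map_nonSpecial_iff (algebraMap L Ω) P').mp (hP'1 ▸ hns)
    · exact (map_onCurve_iff (algebraMap L Ω) k Q').mp (hQ'1 ▸ hQ)
    · apply (algebraMap L Ω).injective
      rw [map_N', map_ratCast, map_zero]
      exact hN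
    · refine (map_collide_iff (algebraMap L Ω) k (c : L) P' Q').mp ?_
      rw [map_ratCast]; exact hcol
  let ψ : L →ₐ[ℚ] AlgebraicClosure ℚ := IsAlgClosed.lift
  have hψ : ψ P'.1 ∈ persistentSet k (c : AlgebraicClosure ℚ) :=
    mem_persistentSet_map ψ.toRingHom hmem
  have h1 := aeval_persPoly_of_mem hk hc hψ
  have hdvd : minpoly ℚ P.1 ∣ persPoly hk hc := by
    have e1 : minpoly ℚ (ψ P'.1) = minpoly ℚ P'.1 := minpoly.algHom_eq ψ ψ.injective _
    have e2 : minpoly ℚ ((IntermediateField.val L) P'.1) = minpoly ℚ P'.1 :=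
      minpoly.algHom_eq (IntermediateField.val L) (IntermediateField.val L).injective _
    rw [← minpoly.dvd_iff] at h1
    rw [e1, ← e2] at h1
    exact h1
  exact aeval_eq_zero_of_dvd_aeval_eq_zero hdvd (minpoly.aeval ℚ _)

/-- **Parameters from a prescribed pool.** For `k ≥ 3`, any INFINITE set `C ⊆ ℚ`, any `n`, and any two
fields `Ω₁, Ω₂` of characteristic `0`, there are `n` distinct nonzero rationals in `C` whose persistent
sets are pairwise disjoint in `Ω₁` and in `Ω₂` (induction: each new parameter avoids `0`, the old ones,
and the finitely many rationals whose persistent set meets an old one, `finite_badParams_of_finite`).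
[cite: MochizukiGenEll2010, Thm 2.1 p.12] -/
theorem exists_finset_params_pairwise_disjoint_of_infinite {Ω₁ Ω₂ : Type*} [Field Ω₁] [CharZero Ω₁]
    [Field Ω₂] [CharZero Ω₂] {k : ℕ} (hk : 3 ≤ k) {C : Set ℚ} (hC : C.Infinite) (n : ℕ) :
    ∃ s : Finset ℚ, s.card = n ∧ (↑s ⊆ C) ∧ (0 : ℚ) ∉ s ∧
      (s : Set ℚ).Pairwise
        (fun c c' => Disjoint (persistentSet k (c : Ω₁)) (persistentSet k (c' : Ω₁))) ∧
      (s : Set ℚ).Pairwise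
        (fun c c' => Disjoint (persistentSet k (c : Ω₂)) (persistentSet k (c' : Ω₂))) := by
  classical
  induction n with
  | zero => exact ⟨∅, rfl, by simp, by simp, by simp, by simp⟩
  | succ n ih =>
    obtain ⟨s, hcard, hsC, h0, h₁, h₂⟩ := ih
    have hk2 : 2 ≤ k := by omega
    have hne : ∀ c ∈ (s : Set ℚ), (c : ℚ) ≠ 0 := fun c hc h => h0 (h ▸ hc)
    have hbad₁ : Set.Finite {q : ℚ | ∃ c ∈ (s : Set ℚ), ∃ a ∈ persistentSet k (c : Ω₁),
        a ∈ persistentSet k (q : Ω₁)} := by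
      refine ((s.finite_toSet).biUnion fun c hc => finite_badParams_of_finite (Ω := Ω₁) hk
        (finite_persistentSet hk2 (Rat.cast_ne_zero.mpr (hne c hc)))).subset ?_
      rintro q ⟨c, hc, a, ha, ha'⟩
      simp only [Set.mem_iUnion, Set.mem_setOf_eq]
      exact ⟨c, hc, a, ha, ha'⟩
    have hbad₂ : Set.Finite {q : ℚ | ∃ c ∈ (s : Set ℚ), ∃ a ∈ persistentSet k (c : Ω₂),
        a ∈ persistentSet k (q : Ω₂)} := by
      refine ((s.finite_toSet).biUnion fun c hc => finite_badParams_of_finite (Ω := Ω₂) hk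
        (finite_persistentSet hk2 (Rat.cast_ne_zero.mpr (hne c hc)))).subset ?_
      rintro q ⟨c, hc, a, ha, ha'⟩
      simp only [Set.mem_iUnion, Set.mem_setOf_eq]
      exact ⟨c, hc, a, ha, ha'⟩
    obtain ⟨q, hqC, hq⟩ := hC.exists_notMem_finset
      (insert (0 : ℚ) s ∪ (hbad₁.toFinset ∪ hbad₂.toFinset))
    simp only [Finset.mem_union, Finset.mem_insert, Set.Finite.mem_toFinset, Set.mem_setOf_eq,
      not_or, not_exists, not_and] at hq
    obtain ⟨⟨hq0, hqs⟩, hq₁, hq₂⟩ := hq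
    refine ⟨insert q s, by rw [Finset.card_insert_of_notMem hqs, hcard], ?_, ?_, ?_, ?_⟩
    · rw [Finset.coe_insert]
      exact Set.insert_subset hqC hsC
    · rw [Finset.mem_insert, not_or]; exact ⟨Ne.symm hq0, h0⟩
    · rw [Finset.coe_insert, Set.pairwise_insert_of_notMem (by exact_mod_cast hqs)]
      refine ⟨h₁, fun c hc => ?_⟩
      have hd : Disjoint (persistentSet k (q : Ω₁)) (persistentSet k (c : Ω₁)) :=
        Set.disjoint_left.mpr fun a haq hac => hq₁ c hc a hac haq
      exact ⟨hd, hd.symm⟩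
    · rw [Finset.coe_insert, Set.pairwise_insert_of_notMem (by exact_mod_cast hqs)]
      refine ⟨h₂, fun c hc => ?_⟩
      have hd : Disjoint (persistentSet k (q : Ω₂)) (persistentSet k (c : Ω₂)) :=
        Set.disjoint_left.mpr fun a haq hac => hq₂ c hc a hac haq
      exact ⟨hd, hd.symm⟩

/-- **The persistent family drawn from a pool, for all fields at once.** For `k ≥ 3`, any infinite
`C ⊆ ℚ` and any `n`: an injective `c : Fin n → ℚ` with values in `C ∖ {0}` and nonzero pairwise coprime
`Pers_i ∈ ℚ[X]` such that, in EVERY field `Ω` of characteristic `0`, `Pers_i` vanishes on the persistent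
set of `c_i` (the `c_i` are chosen once, in `Q̄`; `Pers_i` is the product of the minimal polynomials
over its finite persistent set there). [cite: MochizukiGenEll2010, Thm 2.1 p.12] -/
theorem exists_persistent_polys_of_infinite {k : ℕ} (hk : 3 ≤ k) {C : Set ℚ} (hC : C.Infinite)
    (n : ℕ) :
    ∃ (c : Fin n → ℚ) (Pers : Fin n → ℚ[X]), (∀ i, c i ∈ C) ∧ (∀ i, c i ≠ 0) ∧
      Function.Injective c ∧ (∀ i, Pers i ≠ 0) ∧
      Pairwise (fun i j => IsCoprime (Pers i) (Pers j)) ∧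
      ∀ (Ω : Type*) [Field Ω] [CharZero Ω],
        ∀ i, ∀ a ∈ persistentSet k (c i : Ω), aeval a (Pers i) = 0 := by
  classical
  have hk2 : 2 ≤ k := by omega
  obtain ⟨s, hcard, hsC, h0, hdisj, -⟩ := exists_finset_params_pairwise_disjoint_of_infinite
    (Ω₁ := AlgebraicClosure ℚ) (Ω₂ := AlgebraicClosure ℚ) hk hC n
  let e : Fin n ≃ s := (s.equivFinOfCardEq hcard).symm
  have hc0 : ∀ i, ((e i : ℚ)) ≠ 0 := fun i h => h0 (h ▸ (e i).2)
  refine ⟨fun i => (e i : ℚ), fun i => persPoly hk2 (hc0 i), fun i => hsC (e i).2, hc0, ?_,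
    fun i => persPoly_ne_zero hk2 (hc0 i), ?_,
    fun Ω _ _ i a ha => aeval_persPoly_eq_zero_of_charZero hk2 (hc0 i) ha⟩
  · intro i j h
    exact e.injective (Subtype.ext h)
  · intro i j hij
    exact isCoprime_persPoly hk2 (hc0 i) (hc0 j)
      (hdisj (e i).2 (e j).2 (fun h => hij (e.injective (Subtype.ext h))))

/-- The pool-free special case: for `k ≥ 3` and any `n`, nonzero injective `c : Fin n → ℚ` and nonzero
pairwise coprime `Pers_i ∈ ℚ[X]` with root containment over the persistent set of `c_i` in EVERY field
of characteristic `0` at once. [cite: MochizukiGenEll2010, Thm 2.1 p.12] -/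
theorem exists_persistent_polys_allFields {k : ℕ} (hk : 3 ≤ k) (n : ℕ) :
    ∃ (c : Fin n → ℚ) (Pers : Fin n → ℚ[X]), (∀ i, c i ≠ 0) ∧ Function.Injective c ∧
      (∀ i, Pers i ≠ 0) ∧ Pairwise (fun i j => IsCoprime (Pers i) (Pers j)) ∧
      ∀ (Ω : Type*) [Field Ω] [CharZero Ω],
        ∀ i, ∀ a ∈ persistentSet k (c i : Ω), aeval a (Pers i) = 0 := by
  obtain ⟨c, Pers, -, hc0, hinj, hP0, hcop, hroots⟩ :=
    exists_persistent_polys_of_infinite hk Set.infinite_univ n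
  exact ⟨c, Pers, hc0, hinj, hP0, hcop, hroots⟩

/-- **The pooled family in the `t_c`-value form.** For `k ≥ 3`, any infinite `C ⊆ ℚ` and any `n`: an
injective `c : Fin n → C ∖ {0}` and nonzero pairwise coprime `Pers_i ∈ ℚ[X]` such that, in EVERY field
`Ω` of characteristic `0`, `Pers_i` vanishes at `x(z)` for every non-polar point `z` of `D_e` sharing its
`t_{c_i}`-value `((1−2x) + c_i r^{k+2})/(r(1−2x))` with a `t_{c_i}`-critical point `w` (`N k c_i w = 0`)
— the hypothesis `hCV` of the configuration-protection step with `CV :=` the critical values of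
`t_{c_i}`. [cite: MochizukiGenEll2010, Thm 2.1 p.12] -/
theorem exists_persistent_polys_tval_of_infinite {k : ℕ} (hk : 3 ≤ k) {C : Set ℚ}
    (hC : C.Infinite) (n : ℕ) :
    ∃ (c : Fin n → ℚ) (Pers : Fin n → ℚ[X]), (∀ i, c i ∈ C) ∧ (∀ i, c i ≠ 0) ∧
      Function.Injective c ∧ (∀ i, Pers i ≠ 0) ∧
      Pairwise (fun i j => IsCoprime (Pers i) (Pers j)) ∧
      ∀ (Ω : Type*) [Field Ω] [CharZero Ω],
        ∀ i, ∀ z w : Ω × Ω, OnCurve k z → z.2 ≠ 0 → 1 - 2 * z.1 ≠ 0 → OnCurve k w →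
          N k (c i : Ω) w = 0 →
          ((1 - 2 * z.1) + (c i : Ω) * z.2 ^ (k + 2)) / (z.2 * (1 - 2 * z.1)) =
            ((1 - 2 * w.1) + (c i : Ω) * w.2 ^ (k + 2)) / (w.2 * (1 - 2 * w.1)) →
          aeval z.1 (Pers i) = 0 := by
  obtain ⟨c, Pers, hcC, hc0, hinj, hP0, hcop, hroots⟩ := exists_persistent_polys_of_infinite hk hC n
  refine ⟨c, Pers, hcC, hc0, hinj, hP0, hcop, fun Ω _ _ i z w hz hr hs hw hN ht => ?_⟩
  exact hroots Ω i z.1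
    (mem_persistentSet_of_tval_eq (Rat.cast_ne_zero.mpr (hc0 i)) hz ⟨hr, hs⟩ hw hN ht)

/-- Non-vacuity of the pool hypothesis for the closing choice: `{2^j : j ∈ ℕ} ⊆ ℚ` is infinite.
[cite: MochizukiGenEll2010, Thm 2.1 p.12] -/
theorem infinite_range_two_pow : (Set.range fun j : ℕ => (2 : ℚ) ^ j).Infinite :=
  Set.infinite_range_of_injective (pow_right_injective₀ (by norm_num) (by norm_num))

/-- The signed pool `{± 2^j}` is infinite as well (it contains `{2^j}`).
[cite: MochizukiGenEll2010, Thm 2.1 p.12] -/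
theorem infinite_setOf_abs_eq_two_pow :
    {c : ℚ | ∃ j : ℕ, c = 2 ^ j ∨ c = -(2 ^ j)}.Infinite :=
  infinite_range_two_pow.mono (by rintro _ ⟨j, rfl⟩; exact ⟨j, Or.inl rfl⟩)

end DeFamily

end Literature.NumberTheory.DiophantineGeometry.GenEll
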